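import Mathlib

/-!
# The exterior-algebra identities behind the (2,2)-cocycle of four line-forms (T3.1, R-A(c); seat t3-p1 g2)

Bergeron–Millson–Moeglin (Acta Math. 216 (2016), the special cocycles `ψ_{bq,aq}` of the unitary
dual pair, held as arXiv:1306.1515) build the `(bq,aq)`-cocycle as the OUTER exterior product of
`b` holomorphic and `a` anti-holomorphic line-forms (their factorization lemma and definition
`ψ_{bq,aq} = ψ_{bq,0} ∧ ψ_{0,aq}`), and evaluate it on the Vogan–Zuckerman vector as a product of
two determinants, `ψ_{bq,aq}(e(bq,aq)) = Δ̃_a(x')^q · Δ_b(y'')^q` (their values proposition).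
The route uses the instance `(p,q) = (2,1)`, `a = b = 2`: four line-forms of degree one.

This file records the finite multilinear algebra of that instance over an arbitrary commutative
coefficient ring `R` (the polynomial Fock space) and an arbitrary `R`-module `M` (the cotangent
space `𝔭^*`), in Mathlib's `ExteriorAlgebra R M`:

* `ιMulti_eq_det_smul` — the general Leibniz identity: the wedge of `n` vectors written in a basis
  `e` of a free module of rank `n` with coefficient matrix `A` is `det A • (e 0 ∧ ⋯ ∧ e (n-1))`
  (the values proposition at `q = 1`, `b = n`, by alternation instead of Zariski density);
* `wedge_two_eq_det` — the `(2,0)`-value: `ι(z₁ξ₁ + z₂ξ₂) ∧ ι(w₁ξ₁ + w₂ξ₂) = det [[z₁,z₂],[w₁,w₂]] • (ιξ₁ ∧ ιξ₂)`;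
* `wedge_four_eq_det_mul_det` — the `(2,2)`-value as the product of the two `2 × 2` determinants
  times the volume element `ιξ'₁ ∧ ιξ'₂ ∧ ιξ''₁ ∧ ιξ''₂`;
* `reorder_odd_four` — the sign of regrouping four odd line-forms, `(a ∧ c) ∧ (b ∧ d) = −(a ∧ b) ∧ (c ∧ d)`
  (the sign between `ψ_{2,0} ∧ ψ_{0,2}` and the two-fold product of `(1,1)`-forms).

Nothing here is specific to theta series: the statements are identities in the exterior algebra.
-/

set_option autoImplicit false

namespace HodgeRepro.T3P1.FockWedge

open ExteriorAlgebra Module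

variable {R : Type*} [CommRing R] {M : Type*} [AddCommGroup M] [Module R M]

/-- Two degree-one elements of the exterior algebra anticommute. -/
theorem ι_mul_ι_eq_neg (x y : M) : ι R x * ι R y = -(ι R y * ι R x) :=
  eq_neg_of_add_eq_zero_left (ι_add_mul_swap x y)

/-- The `(2,0)`-value (BMM's values proposition at `b = 2`, `q = 1`, by direct computation):
the wedge of two linear combinations of `ξ₁, ξ₂` is the `2 × 2` determinant of the coefficients
times `ιξ₁ ∧ ιξ₂`. -/
theorem wedge_two_eq_det (ξ₁ ξ₂ : M) (z₁ z₂ w₁ w₂ : R) :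
    ι R (z₁ • ξ₁ + z₂ • ξ₂) * ι R (w₁ • ξ₁ + w₂ • ξ₂)
      = Matrix.det !![z₁, z₂; w₁, w₂] • (ι R ξ₁ * ι R ξ₂) := by
  rw [Matrix.det_fin_two_of]
  simp only [map_add, map_smul, add_mul, mul_add, smul_mul_assoc, mul_smul_comm, ι_sq_zero,
    smul_zero, add_zero, zero_add]
  rw [ι_mul_ι_eq_neg ξ₂ ξ₁]
  module

/-- The `(2,2)`-value: two line-forms on the `(1,0)`-side (in `ξ'₁, ξ'₂`) and two on the
`(0,1)`-side (in `ξ''₁, ξ''₂`); their product is the product of the two `2 × 2` determinants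
times the volume element `ιξ'₁ ∧ ιξ'₂ ∧ ιξ''₁ ∧ ιξ''₂` (BMM's values proposition, item (3),
at `(p,q) = (2,1)`, `a = b = 2`). -/
theorem wedge_four_eq_det_mul_det (ξ'₁ ξ'₂ ξ''₁ ξ''₂ : M) (z₁ z₂ w₁ w₂ u₁ u₂ t₁ t₂ : R) :
    (ι R (z₁ • ξ'₁ + z₂ • ξ'₂) * ι R (w₁ • ξ'₁ + w₂ • ξ'₂)) *
      (ι R (u₁ • ξ''₁ + u₂ • ξ''₂) * ι R (t₁ • ξ''₁ + t₂ • ξ''₂))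
      = (Matrix.det !![z₁, z₂; w₁, w₂] * Matrix.det !![u₁, u₂; t₁, t₂]) •
          ((ι R ξ'₁ * ι R ξ'₂) * (ι R ξ''₁ * ι R ξ''₂)) := by
  rw [wedge_two_eq_det, wedge_two_eq_det, smul_mul_assoc, mul_smul_comm, smul_smul]

/-- Regrouping four odd elements: `(a ∧ c) ∧ (b ∧ d) = −((a ∧ b) ∧ (c ∧ d))`.  With `a, c` the two
`(1,0)`-line-forms and `b, d` the two `(0,1)`-line-forms this is the sign between
`ψ_{2,0} ∧ ψ_{0,2}` and `ψ_{1,1} ∧ ψ_{1,1}`. -/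
theorem reorder_odd_four (a b c d : M) :
    (ι R a * ι R c) * (ι R b * ι R d) = -((ι R a * ι R b) * (ι R c * ι R d)) := by
  calc (ι R a * ι R c) * (ι R b * ι R d) = ι R a * (ι R c * ι R b) * ι R d := by
        simp only [mul_assoc]
    _ = ι R a * (-(ι R b * ι R c)) * ι R d := by rw [ι_mul_ι_eq_neg c b]
    _ = -((ι R a * ι R b) * (ι R c * ι R d)) := by
        simp only [mul_neg, neg_mul, mul_assoc]

/-- The Leibniz identity for the wedge of `n` vectors in a free module with basis `e` indexed by
`Fin n`: if `v i = ∑ j, A i j • e j` then `ιMulti R n v = det A • ιMulti R n e`.  This is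
BMM's values proposition `ψ_{bq,0}(e(bq,0)) = Δ_b(y'')^q` at `q = 1` for `b = n`, proved by
alternation (`Module.Basis.ext_alternating`) rather than by Zariski density. -/
theorem ιMulti_eq_det_smul {n : ℕ} (e : Basis (Fin n) R M) (A : Matrix (Fin n) (Fin n) R) :
    ιMulti R n (fun i => ∑ j, A i j • e j) = A.det • ιMulti R n e := by
  classical
  -- the alternating map `v ↦ e.det v • ιMulti R n e`
  let G : M [⋀^Fin n]→ₗ[R] ExteriorAlgebra R M :=
    ((LinearMap.id : R →ₗ[R] R).smulRight (ιMulti R n e)).compAlternatingMap e.det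
  have hG : ιMulti R n = G := by
    refine e.ext_alternating fun v hv => ?_
    let σ : Equiv.Perm (Fin n) := Equiv.ofBijective v (Finite.injective_iff_bijective.1 hv)
    have hvσ : (fun i => e (v i)) = e ∘ σ := rfl
    rw [hvσ]
    simp only [G, LinearMap.compAlternatingMap_apply, LinearMap.smulRight_apply,
      LinearMap.id_apply, AlternatingMap.map_perm, Basis.det_self]
    simp
  have key : ιMulti R n (fun i => ∑ j, A i j • e j)
      = e.det (fun i => ∑ j, A i j • e j) • ιMulti R n e := by
    conv_lhs => rw [hG]
    simp only [G, LinearMap.compAlternatingMap_apply, LinearMap.smulRight_apply,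
      LinearMap.id_apply]
  rw [key, Basis.det_apply, ← Matrix.det_transpose]
  congr 2
  ext i j
  simp [Basis.toMatrix_apply, Finsupp.single_apply]

end HodgeRepro.T3P1.FockWedge
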